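import Literature.NumberTheory.EllipticCurves.ModifiedTamagawaProduct
import Literature.NumberTheory.EllipticCurves.ZpExtensionProofs
import Literature.NumberTheory.EllipticCurves.BSDSelmerParityDokchitserHeegnerFieldProofs
import Literature.NumberTheory.DiophantineGeometry.ConductorRadicalProofs
import HarnessLib

/-!
# `C(E/M_n)` is a square over the anticyclotomic tower of a Heegner field (Dokchitser–Dokchitser 2010, §4.6)

Topic `NumberTheory/EllipticCurves`. T. Dokchitser, V. Dokchitser, *On the Birch–Swinnerton-Dyer
quotients modulo squares*, Ann. of Math. 172 (2010), §4.6, proof of Thm. 4.19 (= Thm. 1.4), p. 593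
(= arXiv:math/0610290, p. 27). With `E/ℚ`, `M₀` an imaginary quadratic field in which all bad primes
of `E` split, `M_n` the layers of the anticyclotomic `ℤ_p`-extension of `M₀`, `F = M_{n+1}`,
`M = M_n`:

> "Embedding `M_{n+1}` in `ℂ`, complex conjugation acts on the cyclic group `Gal(M_{n+1}/M₀)` as
> `-1`, so `Gal(M_{n+1}/ℚ)` is dihedral. […] Now we invoke Proposition 4.17:
> `rk_p(E/M) + m_ρ ≡ ord_p C(E/F)/C(E/M) (mod 2)`. Since all bad primes of `E` split in `M/K`, the
> root number `w(E/M) = -1` and both `C(E/F)` and `C(E/M)` are squares. So the right-hand side in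
> the above formula is zero, and it suffices to show that `m_ρ` is odd."

This file **proves** the sentence "both `C(E/F)` and `C(E/M)` are squares" for every layer, with
`C(E/L) = (W.baseChange L).modifiedTamagawaProduct` the tree's rendering of the authors'
`C(E/L) = ∏_{w∤∞} c_w |ω/ω_w°|_w` (file `ModifiedTamagawaProduct`; `ω` = the differential of the
chosen `ℚ`-model, the same for all `L` as the authors prescribe), for a global minimal model
`W = W₀ ⊗ ℚ` of `E`:

* `ZpExtension.isSquare_modifiedTamagawaProduct_baseChange_layer` — for `W₀` a Weierstrass model over
  `ℤ` with `Δ(W₀) ≠ 0`, minimal at every prime, `K` imaginary quadratic satisfying the Heegner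
  hypothesis for the conductor `N_E` (`SatisfiesHeegnerHypothesis (W.conductorNorm ℤ) K`, the
  hypothesis of the tree's `dokchitser_selmerCorank_baseChange_mod_two_eq`), `κ` an anticyclotomic
  `ℤ_p`-extension of `K` (`κ.IsAnticyclotomic`; any prime `p`) and every `n`:
  **`C(W/K_n)` is a square in `ℚ`**, `K_n = κ.layer n`;
* `ZpExtension.isSquare_modifiedTamagawaProduct_baseChange_layer_of_natAbs` — the same with the
  Heegner hypothesis for `|Δ(W₀)|` in place of `N_E` and no minimality (for a global minimal model
  the two sets of primes coincide: `radical_conductorNorm_eq`, `minimalDiscriminantNorm_eq_natAbs`).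

It thereby shrinks the "dihedral congruence" input `h417` of the tree's reductions
(`dokchitser_selmerCorank_baseChange_mod_two_eq_of_printed''`, `…_of_h417_of_hCV`) to Prop. 4.17 of
the paper as printed.

## The printed argument, and its formalisation

Complex conjugation, transported to `K̄ = AlgebraicClosure K` (the tree's `absGaloisTransport c₀` of
a complex conjugation `c₀ ∈ Γ_ℚ`, which is not a restriction from `Γ_K`:
`exists_not_mem_range_absGaloisRestrict`, file `ZpExtensionProofs`), normalises the image of `Γ_K`
and — `κ` being anticyclotomic, `κ(c τ c⁻¹) = κ(τ)⁻¹` — preserves each `κ⁻¹(pⁿℤ_p) = Gal(K̄/K_n)`,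
hence restricts to a **`ℚ`-involution `c` of the layer `K_n`** acting non-trivially on `K`
(`ZpExtension.layerInvolution`, `layerInvolution_mul_self`, `exists_layerInvolution_algebraMap_ne`;
this is "`Gal(M_{n+1}/ℚ)` is dihedral"). A finite place `w` of `K_n` fixed by `c` lies over a prime
`𝔮` of `K` fixed by the non-trivial automorphism of `K/ℚ` (`under_smul_asIdeal`), which is then the
only prime of `K` above the rational prime `ℓ` below it (transitivity of `Gal(K/ℚ)` on the primes
above `ℓ`, Mathlib's `Ideal.exists_smul_eq_of_isGaloisGroup`): so `ℓ` does not split in `K`, and by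
the Heegner hypothesis `ℓ ∤ N_E` (`layerInvolution_smul_ne`); at such places the local factor of the
global minimal model is `1` (`localTamagawaFactor_baseChange_int_eq_one`, file
`ModifiedTamagawaProduct`: good reduction, `c_w = 1`, `ω` stays a Néron differential). The bad
places therefore come in pairs `{w, c w}` with equal local factors (Galois invariance,
`localTamagawaFactor_algEquiv_smul`), and `C(W/K_n) = ∏_w C_w` is a square
(`isSquare_modifiedTamagawaProduct_of_algEquiv`).

Everything is proved; the only definition is the involution `ZpExtension.layerInvolution`
(data: a `ℚ`-algebra automorphism of `κ.layer n`), needed again to form the real subfields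
`K_n ∩ ℝ = (κ.layer n)^c` of Prop. 4.17. No named facts (D-0026).

## References

* [DokchitserDokchitserAnnals2010] T. Dokchitser, V. Dokchitser, Ann. of Math. 172 (2010),
  567–596 = arXiv:math/0610290: §4.6, proof of Thm. 4.19 (p. 27); §1 Notation (pp. 4–5).
* [Greenberg1987] R. Greenberg, *Non-vanishing of certain values of `L`-functions*, Progr. Math. 70
  (1987), §2 (the anticyclotomic `ℤ_p`-extension: `c` acts on `Gal(K_∞⁻/K)` by `-1`, `K_∞⁻/ℚ`
  Galois, generalised dihedral).
* [GrossLMS1991] B. H. Gross, *Kolyvagin's work on modular elliptic curves*, LMS LN 153 (1991), §3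
  (complex conjugation lifts to an involution of the ring class fields; primes split in `K`).
* [CasselsFrohlichANT1967] Cassels–Fröhlich, *Algebraic Number Theory*, Ch. VII §1.1, Prop. 1.2 (ii)
  (conjugate primes, transitivity).
-/

noncomputable section

open Field
open Literature.NumberTheory.GaloisRepresentations

universe u

namespace Literature.NumberTheory.EllipticCurves

/-! ### The involution of the layers of an anticyclotomic `ℤ_p`-extension -/

namespace ZpExtension

variable {K : Type u} [Field K] [NumberField K] {p : ℕ} [Fact p.Prime] (κ : ZpExtension K p)

omit [NumberField K] in
/-- Membership in the layer `K_n = K̄^{κ⁻¹(pⁿℤ_p)}`: `x ∈ K_n ↔ τ • x = x` for all `τ ∈ κ⁻¹(pⁿℤ_p)`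
(unfolding `IntermediateField.fixedField` through the identity `absoluteGaloisGroup.toAlgEquiv`).
Washington, *Introduction to Cyclotomic Fields*, §13.1. [folklore] -/
theorem mem_layer_iff (n : ℕ) (x : AlgebraicClosure K) :
    x ∈ κ.layer n ↔ ∀ τ ∈ κ.layerSubgroup n, τ • x = x := by
  rw [layer, IntermediateField.mem_fixedField_iff]
  constructor
  · intro h τ hτ
    exact h _ ⟨τ, hτ, rfl⟩
  · rintro h f ⟨τ, hτ, rfl⟩
    exact h τ hτ

variable {κ}

/-- **Conjugation by `c₀` inside `Γ_K`.** For `[K : ℚ] = 2` and `c₀ ∈ Γ_ℚ` outside the image of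
`Γ_K → Γ_ℚ` (an index-`2` subgroup, `inv_mul_mem_range_absGaloisRestrict`), every `τ ∈ Γ_K` has a
conjugate `τ' ∈ Γ_K` with `res τ' = c₀⁻¹ (res τ) c₀` (the image is normal). Greenberg (1987), §2.
[folklore] -/
theorem exists_absGaloisRestrict_eq_conj (hK : Module.finrank ℚ K = 2)
    {c₀ : absoluteGaloisGroup ℚ} (hc₀ : c₀ ∉ Set.range (absGaloisRestrict ℚ K))
    (τ : absoluteGaloisGroup K) :
    ∃ τ' : absoluteGaloisGroup K,
      absGaloisRestrict ℚ K τ' = c₀⁻¹ * absGaloisRestrict ℚ K τ * c₀ := by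
  have h : absGaloisRestrict ℚ K τ * c₀ ∉ Set.range (absGaloisRestrict ℚ K) := by
    rintro ⟨σ, hσ⟩
    exact hc₀ ⟨τ⁻¹ * σ, by rw [map_mul, map_inv, hσ, inv_mul_cancel_left]⟩
  obtain ⟨τ', hτ'⟩ := inv_mul_mem_range_absGaloisRestrict hK hc₀ h
  exact ⟨τ', by rw [hτ', mul_assoc]⟩

/-- **Anticyclotomy on conjugates**: if `res τ' = c₀⁻¹ (res τ) c₀` with `c₀` outside the image of
`Γ_K` and `κ` is anticyclotomic, then `κ τ' = (κ τ)⁻¹` (the defining property `IsAnticyclotomic`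
at `ρ = c₀⁻¹`). Greenberg (1987), §2: "`c` acts on `Gal(K_∞⁻/K)` by `-1`". [cite: Greenberg1987, §2] -/
theorem apply_eq_inv_of_absGaloisRestrict_eq_conj (hκ : κ.IsAnticyclotomic)
    {c₀ : absoluteGaloisGroup ℚ} (hc₀ : c₀ ∉ Set.range (absGaloisRestrict ℚ K))
    {τ τ' : absoluteGaloisGroup K}
    (h : absGaloisRestrict ℚ K τ' = c₀⁻¹ * absGaloisRestrict ℚ K τ * c₀) :
    κ τ' = (κ τ)⁻¹ := by
  have hc₀' : c₀⁻¹ ∉ Set.range (absGaloisRestrict ℚ K) := by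
    rintro ⟨σ, hσ⟩
    exact hc₀ ⟨σ⁻¹, by rw [map_inv, hσ, inv_inv]⟩
  exact hκ τ τ' c₀⁻¹ hc₀' (by rw [h, inv_inv])

omit [NumberField K] in
/-- If `κ τ' = (κ τ)⁻¹` then `τ'` and `τ` lie in the same subgroups `κ⁻¹(pⁿℤ_p)` (`pⁿ ∣ -x ↔ pⁿ ∣ x`).
[folklore] -/
theorem mem_layerSubgroup_iff_of_apply_eq_inv {τ τ' : absoluteGaloisGroup K}
    (h : κ τ' = (κ τ)⁻¹) (n : ℕ) : τ' ∈ κ.layerSubgroup n ↔ τ ∈ κ.layerSubgroup n := by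
  rw [mem_layerSubgroup, mem_layerSubgroup, h, toAdd_inv, dvd_neg]

/-- **The transported conjugation stabilises every layer.** For `[K : ℚ] = 2`, `κ` anticyclotomic and
`c₀ ∈ Γ_ℚ` outside the image of `Γ_K`, the `ℚ`-automorphism `e c₀ e⁻¹` of `K̄`
(`absGaloisTransport c₀`, file `ZpExtensionProofs`) maps `K_n` into `K_n`: for `τ ∈ Gal(K̄/K_n)` and
`x ∈ K_n`, `τ • (c x) = c (τ' • x) = c x` with `τ'` the `c₀`-conjugate of `τ`, again in `Gal(K̄/K_n)`
by anticyclotomy — the statement "`K_n/ℚ` is Galois (generalised dihedral)" of Greenberg (1987), §2;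
Dokchitser–Dokchitser §4.6: "`Gal(M_{n+1}/ℚ)` is dihedral". [cite: Greenberg1987, §2] -/
theorem absGaloisTransport_mem_layer (hK : Module.finrank ℚ K = 2) (hκ : κ.IsAnticyclotomic)
    {c₀ : absoluteGaloisGroup ℚ} (hc₀ : c₀ ∉ Set.range (absGaloisRestrict ℚ K)) (n : ℕ)
    {x : AlgebraicClosure K} (hx : x ∈ κ.layer n) :
    absGaloisTransport (K := ℚ) (L := K) c₀ x ∈ κ.layer n := by
  rw [mem_layer_iff] at hx ⊢
  intro τ hτ
  obtain ⟨τ', hτ'⟩ := exists_absGaloisRestrict_eq_conj hK hc₀ τ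
  have hmem : τ' ∈ κ.layerSubgroup n :=
    (mem_layerSubgroup_iff_of_apply_eq_inv
      (apply_eq_inv_of_absGaloisRestrict_eq_conj hκ hc₀ hτ') n).mpr hτ
  have key : τ • absGaloisTransport (K := ℚ) (L := K) c₀ x =
      absGaloisTransport (K := ℚ) (L := K) c₀ (τ' • x) := by
    rw [← absGaloisTransport_absGaloisRestrict (K := ℚ) τ' x, ← AlgEquiv.mul_apply, ← map_mul,
      hτ', ← mul_assoc, ← mul_assoc, mul_inv_cancel, one_mul, map_mul, AlgEquiv.mul_apply,
      absGaloisTransport_absGaloisRestrict]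
  rw [key, hx τ' hmem]

/-- The transport of an element with `c₀² = 1` is an involution of `K̄`. [folklore] -/
theorem absGaloisTransport_absGaloisTransport_of_mul_self {c₀ : absoluteGaloisGroup ℚ}
    (hc : c₀ * c₀ = 1) (x : AlgebraicClosure K) :
    absGaloisTransport (K := ℚ) (L := K) c₀ (absGaloisTransport (K := ℚ) (L := K) c₀ x) = x := by
  rw [← AlgEquiv.mul_apply, ← map_mul, hc, map_one, AlgEquiv.one_apply]

/-- **The involution of the `n`-th layer of an anticyclotomic `ℤ_p`-extension** of a quadratic
field `K`: the restriction to `K_n = κ.layer n` of the transported involution `e c₀ e⁻¹` of `K̄`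
(`c₀ ∈ Γ_ℚ ∖ res(Γ_K)` with `c₀² = 1`, e.g. a complex conjugation for `K` imaginary), a `ℚ`-algebra
automorphism of `K_n` of order `≤ 2` (`layerInvolution_mul_self`) moving `K`
(`exists_layerInvolution_algebraMap_ne`). In Dokchitser–Dokchitser §4.6 this is complex conjugation
on the dihedral field `M_{n+1}`, with fixed field `L = M_{n+1} ∩ ℝ`. Greenberg (1987), §2.
[cite: DokchitserDokchitserAnnals2010, §4.6, proof of Thm. 4.19 (arXiv p. 26)] -/
def layerInvolution (hK : Module.finrank ℚ K = 2) (hκ : κ.IsAnticyclotomic)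
    {c₀ : absoluteGaloisGroup ℚ} (hc₀ : c₀ ∉ Set.range (absGaloisRestrict ℚ K))
    (hc : c₀ * c₀ = 1) (n : ℕ) : κ.layer n ≃ₐ[ℚ] κ.layer n where
  toFun x := ⟨absGaloisTransport (K := ℚ) (L := K) c₀ x,
    absGaloisTransport_mem_layer hK hκ hc₀ n x.2⟩
  invFun x := ⟨absGaloisTransport (K := ℚ) (L := K) c₀ x,
    absGaloisTransport_mem_layer hK hκ hc₀ n x.2⟩
  left_inv x := Subtype.ext (absGaloisTransport_absGaloisTransport_of_mul_self hc (x : AlgebraicClosure K))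
  right_inv x := Subtype.ext (absGaloisTransport_absGaloisTransport_of_mul_self hc (x : AlgebraicClosure K))
  map_mul' x y := Subtype.ext (map_mul (absGaloisTransport (K := ℚ) (L := K) c₀)
    (x : AlgebraicClosure K) (y : AlgebraicClosure K))
  map_add' x y := Subtype.ext (map_add (absGaloisTransport (K := ℚ) (L := K) c₀)
    (x : AlgebraicClosure K) (y : AlgebraicClosure K))
  commutes' q := by
    apply Subtype.ext
    change absGaloisTransport (K := ℚ) (L := K) c₀
        (algebraMap (κ.layer n) (AlgebraicClosure K) (algebraMap ℚ (κ.layer n) q)) =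
      algebraMap (κ.layer n) (AlgebraicClosure K) (algebraMap ℚ (κ.layer n) q)
    rw [← IsScalarTower.algebraMap_apply ℚ (κ.layer n) (AlgebraicClosure K) q, eq_ratCast, map_ratCast]

/-- `layerInvolution` on underlying elements of `K̄` is the transport `e c₀ e⁻¹` (definitional).
[folklore] -/
@[simp] theorem coe_layerInvolution_apply (hK : Module.finrank ℚ K = 2) (hκ : κ.IsAnticyclotomic)
    {c₀ : absoluteGaloisGroup ℚ} (hc₀ : c₀ ∉ Set.range (absGaloisRestrict ℚ K))
    (hc : c₀ * c₀ = 1) (n : ℕ) (x : κ.layer n) :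
    ((layerInvolution hK hκ hc₀ hc n x : κ.layer n) : AlgebraicClosure K) =
      absGaloisTransport (K := ℚ) (L := K) c₀ x := rfl

/-- `layerInvolution` has order dividing `2`. [folklore] -/
theorem layerInvolution_mul_self (hK : Module.finrank ℚ K = 2) (hκ : κ.IsAnticyclotomic)
    {c₀ : absoluteGaloisGroup ℚ} (hc₀ : c₀ ∉ Set.range (absGaloisRestrict ℚ K))
    (hc : c₀ * c₀ = 1) (n : ℕ) :
    layerInvolution hK hκ hc₀ hc n * layerInvolution hK hκ hc₀ hc n = 1 := by
  ext x
  exact absGaloisTransport_absGaloisTransport_of_mul_self hc (x : AlgebraicClosure K)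

/-- **`layerInvolution` moves `K`**: some `x ∈ K ⊆ K_n` is not fixed (otherwise `e c₀ e⁻¹` fixes
`K ⊆ K̄` and `c₀` would be a restriction from `Γ_K`, `mem_range_absGaloisRestrict_iff`). So its
restriction to `K` is the non-trivial automorphism of `K/ℚ`. [folklore] -/
theorem exists_layerInvolution_algebraMap_ne (hK : Module.finrank ℚ K = 2) (hκ : κ.IsAnticyclotomic)
    {c₀ : absoluteGaloisGroup ℚ} (hc₀ : c₀ ∉ Set.range (absGaloisRestrict ℚ K))
    (hc : c₀ * c₀ = 1) (n : ℕ) :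
    ∃ x : K, layerInvolution hK hκ hc₀ hc n (algebraMap K (κ.layer n) x) ≠
      algebraMap K (κ.layer n) x := by
  by_contra hall
  push Not at hall
  apply hc₀
  rw [mem_range_absGaloisRestrict_iff]
  intro x
  have h := congrArg (fun y : κ.layer n => (y : AlgebraicClosure K)) (hall x)
  change absGaloisTransport (K := ℚ) (L := K) c₀
      (algebraMap (κ.layer n) (AlgebraicClosure K) (algebraMap K (κ.layer n) x)) =
    algebraMap (κ.layer n) (AlgebraicClosure K) (algebraMap K (κ.layer n) x) at h
  rwa [← IsScalarTower.algebraMap_apply K (κ.layer n) (AlgebraicClosure K) x] at h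

end ZpExtension

/-! ### Conjugate places and the primes of `K` below them -/

section Under

open IsDedekindDomain NumberField
open scoped Pointwise

variable {K : Type u} [Field K] [NumberField K] {Ln : Type*} [Field Ln] [NumberField Ln]
  [Algebra K Ln] [Normal ℚ K]

omit [NumberField K] [NumberField Ln] [Normal ℚ K] in
/-- The map `𝓞 K → 𝓞 L` on underlying elements is `K → L` (definitional, Mathlib's
`inst_ringOfIntegersAlgebra`). [folklore] -/
theorem coe_algebraMap_ringOfIntegers (y : 𝓞 K) :
    ((algebraMap (𝓞 K) (𝓞 Ln) y : 𝓞 Ln) : Ln) = algebraMap K Ln (y : K) := rfl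

/-- Compatibility of `𝓞 K → 𝓞 L` with `g ∈ Aut(L/ℚ)` and its restriction `g|_K ∈ Aut(K/ℚ)`
(`K/ℚ` normal; Mathlib `AlgEquiv.restrictNormal_commutes`). [folklore] -/
theorem algebraMap_restrictNormal_smul (g : Ln ≃ₐ[ℚ] Ln) (y : 𝓞 K) :
    algebraMap (𝓞 K) (𝓞 Ln) (g.restrictNormal K • y) = g • algebraMap (𝓞 K) (𝓞 Ln) y := by
  apply RingOfIntegers.ext
  rw [coe_algebraMap_ringOfIntegers, Literature.NumberTheory.Automorphic.RingOfIntegers.coe_algEquiv_smul,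
    Literature.NumberTheory.Automorphic.RingOfIntegers.coe_algEquiv_smul, coe_algebraMap_ringOfIntegers]
  exact AlgEquiv.restrictNormal_commutes g K (y : K)

/-- **The prime of `K` below a conjugate place**: `(g • w) ∩ 𝓞 K = g|_K • (w ∩ 𝓞 K)` for
`g ∈ Aut(L/ℚ)` and `K/ℚ` normal (Cassels–Fröhlich, Ch. VII §1.1, with `K` in place of the base).
[cite: CasselsFrohlichANT1967, Ch. VII §1.1] -/
theorem under_smul_asIdeal (g : Ln ≃ₐ[ℚ] Ln) (w : HeightOneSpectrum (𝓞 Ln)) :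
    (g • w).asIdeal.under (𝓞 K) = g.restrictNormal K • w.asIdeal.under (𝓞 K) := by
  ext y
  rw [Ideal.mem_pointwise_smul_iff_inv_smul_mem, Ideal.under_def, Ideal.under_def, Ideal.mem_comap,
    Ideal.mem_comap, Literature.NumberTheory.Automorphic.HeightOneSpectrum.smul_asIdeal,
    Ideal.mem_pointwise_smul_iff_inv_smul_mem]
  have hinv : (g.restrictNormal K)⁻¹ = g⁻¹.restrictNormal K :=
    (map_inv (AlgEquiv.restrictNormalHom (F := ℚ) (K₁ := Ln) K) g).symm
  rw [hinv, algebraMap_restrictNormal_smul]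

end Under

/-! ### Primes fixed by the non-trivial automorphism of a quadratic field do not split -/

section Heegner

open IsDedekindDomain NumberField
open scoped Pointwise

variable {K : Type u} [Field K] [NumberField K]

/-- **A prime of a quadratic field fixed by the non-trivial automorphism is the only prime above the
rational prime below it**: `Gal(K/ℚ) = {1, h}` acts transitively on the primes of `𝓞 K` above `(ℓ)`
(Mathlib `Ideal.exists_smul_eq_of_isGaloisGroup`; Cassels–Fröhlich VII Prop. 1.2 (ii)), so if
`h • Q = Q ∋ ℓ` there is exactly one of them — `ℓ` is inert or ramified, not split.
[cite: CasselsFrohlichANT1967, Ch. VII Prop. 1.2 (ii)] -/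
theorem ncard_primesOver_eq_one_of_smul_eq (hK : Module.finrank ℚ K = 2) {h : K ≃ₐ[ℚ] K}
    (hh : h ≠ 1) {Q : Ideal (𝓞 K)} [Q.IsPrime] (hQ : h • Q = Q) {ℓ : ℕ} (hℓ : ℓ.Prime)
    (hmem : (ℓ : 𝓞 K) ∈ Q) : ((Ideal.span {(ℓ : ℤ)}).primesOver (𝓞 K)).ncard = 1 := by
  haveI : Algebra.IsQuadraticExtension ℚ K := ⟨hK⟩
  haveI : Q.LiesOver (Ideal.span {(ℓ : ℤ)}) := Ideal.liesOver_span_of_natCast_mem' hℓ hmem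
  have hcard : Nat.card (K ≃ₐ[ℚ] K) = 2 := by rw [IsGalois.card_aut_eq_finrank, hK]
  obtain ⟨y, -, hy⟩ := (Nat.card_eq_two_iff' (1 : K ≃ₐ[ℚ] K)).mp hcard
  rw [Set.ncard_eq_one]
  refine ⟨Q, Set.eq_singleton_iff_unique_mem.mpr ⟨⟨inferInstance, inferInstance⟩, fun Q' hQ' => ?_⟩⟩
  obtain ⟨hQ'1, hQ'2⟩ := hQ'
  obtain ⟨σ, hσ⟩ := Ideal.exists_smul_eq_of_isGaloisGroup (Ideal.span {(ℓ : ℤ)}) Q Q' (K ≃ₐ[ℚ] K)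
  rw [← hσ]
  by_cases hσ1 : σ = 1
  · rw [hσ1, one_smul]
  · rw [hy σ hσ1, ← hy h hh, hQ]

end Heegner

namespace ZpExtension

open IsDedekindDomain NumberField
open scoped Pointwise

variable {K : Type u} [Field K] [NumberField K] {p : ℕ} [Fact p.Prime] {κ : ZpExtension K p}

/-- **No place of a layer above a prime `ℓ ∣ N` is fixed by the involution**, under the Heegner
hypothesis for `N` ("all primes dividing `N` split in `K`", `SatisfiesHeegnerHypothesis N K`): a
fixed place would lie over a prime of `K` fixed by the non-trivial automorphism of `K/ℚ`
(`under_smul_asIdeal`, `exists_layerInvolution_algebraMap_ne`), the only prime of `K` above `ℓ`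
(`ncard_primesOver_eq_one_of_smul_eq`), whereas there are two. This is "Since all bad primes of `E`
split in `M/K`" in Dokchitser–Dokchitser §4.6, proof of Thm. 4.19.
[cite: DokchitserDokchitserAnnals2010, §4.6, proof of Thm. 4.19 (arXiv p. 27)] -/
theorem layerInvolution_smul_ne (hK : IsImaginaryQuadratic K) (hκ : κ.IsAnticyclotomic)
    {c₀ : absoluteGaloisGroup ℚ} (hc₀ : c₀ ∉ Set.range (absGaloisRestrict ℚ K))
    (hc : c₀ * c₀ = 1) (n : ℕ) {N : ℕ} (hH : SatisfiesHeegnerHypothesis N K)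
    (w : HeightOneSpectrum (𝓞 (κ.layer n))) {ℓ : ℕ} (hℓ : ℓ.Prime) (hℓN : ℓ ∣ N)
    (hℓw : (ℓ : 𝓞 (κ.layer n)) ∈ w.asIdeal) :
    layerInvolution hK.1 hκ hc₀ hc n • w ≠ w := by
  haveI : Algebra.IsQuadraticExtension ℚ K := ⟨hK.1⟩
  intro heq
  set c := layerInvolution hK.1 hκ hc₀ hc n
  -- the restriction of `c` to `K` is non-trivial
  have hcK : c.restrictNormal K ≠ 1 := by
    obtain ⟨x, hx⟩ := exists_layerInvolution_algebraMap_ne hK.1 hκ hc₀ hc n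
    intro h1
    apply hx
    have h := AlgEquiv.restrictNormal_commutes c K x
    rw [h1, AlgEquiv.one_apply] at h
    exact h.symm
  -- the prime of `K` below `w` is fixed by it
  set Q := w.asIdeal.under (𝓞 K) with hQdef
  haveI : Q.IsPrime := Ideal.IsPrime.under (𝓞 K) w.asIdeal
  have hQ : c.restrictNormal K • Q = Q := by
    rw [hQdef, ← under_smul_asIdeal, heq]
  have hmem : (ℓ : 𝓞 K) ∈ Q := by
    rw [hQdef, Ideal.under_def, Ideal.mem_comap, map_natCast]
    exact hℓw
  have h1 := ncard_primesOver_eq_one_of_smul_eq hK.1 hcK hQ hℓ hmem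
  have h2 := hH ℓ hℓ hℓN
  omega

/-! ### `C(E/K_n)` is a square -/

/-- **`C(W₀/K_n)` is a square (Heegner hypothesis for `|Δ(W₀)|`).** For a Weierstrass model `W₀`
over `ℤ` with `Δ(W₀) ≠ 0`, `K` imaginary quadratic in which every prime dividing `Δ(W₀)` splits, `κ`
an anticyclotomic `ℤ_p`-extension of `K` and any `n`: Dokchitser–Dokchitser's
`C(W₀/K_n) = ∏_{w∤∞} c_w |ω/ω_w°|_w` (`modifiedTamagawaProduct`, `ω = ω_{W₀}`) is a square in `ℚ`.
Proof as printed (§4.6, p. 27: "Since all bad primes of `E` split […] both `C(E/F)` and `C(E/M)` are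
squares"): the involution `c` of `K_n` (`layerInvolution`, from a complex conjugation
`exists_not_mem_range_absGaloisRestrict`) fixes the model, a `c`-fixed place lies above a prime
`ℓ ∤ Δ(W₀)` (`layerInvolution_smul_ne`) where the local factor is `1`
(`localTamagawaFactor_baseChange_int_eq_one`), and `isSquare_modifiedTamagawaProduct_of_algEquiv`.
[cite: DokchitserDokchitserAnnals2010, §4.6, proof of Thm. 4.19 (arXiv p. 27)] -/
theorem isSquare_modifiedTamagawaProduct_baseChange_layer_of_natAbs (W₀ : WeierstrassCurve ℤ)
    (hΔ : W₀.Δ ≠ 0) (hK : IsImaginaryQuadratic K)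
    (hsplit : SatisfiesHeegnerHypothesis W₀.Δ.natAbs K) (hκ : κ.IsAnticyclotomic) (n : ℕ) :
    IsSquare (W₀.baseChange (κ.layer n)).modifiedTamagawaProduct := by
  haveI : Algebra.IsQuadraticExtension ℚ K := ⟨hK.1⟩
  haveI : IsTotallyComplex K := hK.2
  obtain ⟨c₀, hc₀, hc⟩ := exists_not_mem_range_absGaloisRestrict (K := ℚ) K (Rat.castHom ℝ)
    IsTotallyComplex.isComplex
  haveI : (W₀.baseChange (κ.layer n)).IsElliptic := by
    refine ⟨isUnit_iff_ne_zero.mpr ?_⟩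
    rw [WeierstrassCurve.baseChange, WeierstrassCurve.map_Δ, eq_intCast, Int.cast_ne_zero]
    exact hΔ
  refine WeierstrassCurve.isSquare_modifiedTamagawaProduct_of_algEquiv _
    (layerInvolution hK.1 hκ hc₀ hc n) (layerInvolution_mul_self hK.1 hκ hc₀ hc n) ?_ fun w hw => ?_
  · rw [WeierstrassCurve.baseChange, WeierstrassCurve.map_map]
    congr 1
    exact Subsingleton.elim _ _
  · obtain ⟨ℓ, hℓ, hℓw⟩ : ∃ ℓ : ℕ, ℓ.Prime ∧ (ℓ : 𝓞 (κ.layer n)) ∈ w.asIdeal :=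
      ⟨_, Nat.absNorm_under_prime w.asIdeal, Int.absNorm_under_mem w.asIdeal⟩
    by_cases hd : (ℓ : ℤ) ∣ W₀.Δ
    · exact absurd hw
        (layerInvolution_smul_ne hK hκ hc₀ hc n hsplit w hℓ (Int.natCast_dvd.mp hd) hℓw)
    · have h1 := WeierstrassCurve.localTamagawaFactor_baseChange_int_eq_one W₀ hΔ w hℓ hℓw hd
      refine ⟨1, ?_⟩
      rw [mul_one]
      -- the two `ℤ`-algebra structures on `κ.layer n` give the same base change
      convert h1 using 2
      rw [WeierstrassCurve.baseChange, WeierstrassCurve.baseChange]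
      congr 1

/-- **`C(E/M_n)` is a square over the anticyclotomic tower of a Heegner field** (Dokchitser–Dokchitser
2010, §4.6, proof of Thm. 4.19, p. 27: "Since all bad primes of `E` split in `M/K`, […] both `C(E/F)`
and `C(E/M)` are squares", `F = M_{n+1}`, `M = M_n`). For a global minimal Weierstrass model
`W = W₀ ⊗ ℚ` of `E/ℚ` (`W₀` over `ℤ`, `Δ(W₀) ≠ 0`, minimal at every prime), `K` imaginary quadratic
satisfying the Heegner hypothesis for the conductor `N_E = W.conductorNorm ℤ` (the hypothesis of the
tree's `dokchitser_selmerCorank_baseChange_mod_two_eq`), `κ` an anticyclotomic `ℤ_p`-extension of `K`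
and every `n`: `C(W/K_n)` — computed with the differential `ω` of `W`, the same for every layer, as the
authors prescribe — is a square in `ℚ`. Reduced to the `|Δ(W₀)|`-form by `radical_conductorNorm_eq`
(`N_E` and `|Δ_min|` have the same prime divisors) and `minimalDiscriminantNorm_eq_natAbs`
(`|Δ_min| = |Δ(W₀)|` for a global minimal model).
[cite: DokchitserDokchitserAnnals2010, §4.6, proof of Thm. 4.19 (arXiv p. 27)] -/
theorem isSquare_modifiedTamagawaProduct_baseChange_layer (W₀ : WeierstrassCurve ℤ) (hΔ : W₀.Δ ≠ 0)
    (hmin : ∀ v : HeightOneSpectrum ℤ, (W₀.baseChange ℚ).IsMinimalAt v)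
    (hK : IsImaginaryQuadratic K)
    (hH : SatisfiesHeegnerHypothesis ((W₀.baseChange ℚ).conductorNorm ℤ) K)
    (hκ : κ.IsAnticyclotomic) (n : ℕ) :
    IsSquare (W₀.baseChange (κ.layer n)).modifiedTamagawaProduct := by
  refine isSquare_modifiedTamagawaProduct_baseChange_layer_of_natAbs W₀ hΔ hK
    (fun ℓ hℓ hℓd => hH ℓ hℓ ?_) hκ n
  haveI : (W₀.baseChange ℚ).IsElliptic := by
    refine ⟨isUnit_iff_ne_zero.mpr ?_⟩
    rw [WeierstrassCurve.baseChange, WeierstrassCurve.map_Δ, eq_intCast, Int.cast_ne_zero]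
    exact hΔ
  have hmD : (W₀.baseChange ℚ).minimalDiscriminantNorm ℤ = W₀.Δ.natAbs :=
    WeierstrassCurve.minimalDiscriminantNorm_eq_natAbs_holds W₀ hΔ hmin
  have hrad := WeierstrassCurve.radical_conductorNorm_eq_holds (W₀.baseChange ℚ)
  have hmem : ℓ ∈ ((W₀.baseChange ℚ).minimalDiscriminantNorm ℤ).primeFactors := by
    rw [hmD, Nat.mem_primeFactors]
    exact ⟨hℓ, hℓd, Int.natAbs_ne_zero.mpr hΔ⟩
  rw [← Nat.primeFactors_radical, ← hrad, Nat.primeFactors_radical, Nat.mem_primeFactors] at hmem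
  exact hmem.2.1

/-- The same over the base change `(W₀ ⊗ ℚ) ⊗ K_n` of the `ℚ`-model (the form in which the tree's
reductions base-change `W : WeierstrassCurve ℚ` to the layers; `baseChange_baseChange_of_rat`).
[cite: DokchitserDokchitserAnnals2010, §4.6, proof of Thm. 4.19 (arXiv p. 27)] -/
theorem isSquare_modifiedTamagawaProduct_baseChange_rat_layer (W₀ : WeierstrassCurve ℤ)
    (hΔ : W₀.Δ ≠ 0) (hmin : ∀ v : HeightOneSpectrum ℤ, (W₀.baseChange ℚ).IsMinimalAt v)
    (hK : IsImaginaryQuadratic K)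
    (hH : SatisfiesHeegnerHypothesis ((W₀.baseChange ℚ).conductorNorm ℤ) K)
    (hκ : κ.IsAnticyclotomic) (n : ℕ) :
    IsSquare ((W₀.baseChange ℚ).baseChange (κ.layer n)).modifiedTamagawaProduct := by
  have h : (W₀.baseChange ℚ).baseChange (κ.layer n) = W₀.baseChange (κ.layer n) := by
    rw [WeierstrassCurve.baseChange, WeierstrassCurve.baseChange, WeierstrassCurve.baseChange,
      WeierstrassCurve.map_map]
    congr 1
    exact Subsingleton.elim _ _
  rw [h]
  exact isSquare_modifiedTamagawaProduct_baseChange_layer W₀ hΔ hmin hK hH hκ n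

end ZpExtension

end Literature.NumberTheory.EllipticCurves
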